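import Summits.AtomisticToContinuum.Crystallization.Theorems.FrustratedLawDichotomyCoherentFloor

/-!
# FrustratedLawDichotomy · crux `AperiodicFrustratedLawGap` (stmt-AtomisticToContinuum-27623) — TRUNCATION TAILS FOR THE CLASS-A CERTIFICATE FLOOR, I:
# THE NASH COLUMN (hdef side, class A: analytic tails that let a cell K-file evaluate the NASH column of `certFloor` on NEAR sites with NEAR
# adjoint coefficients only; decomp-a2c hand-1 g52, for the CELL-SOUND master lemma of lens-5 CELLSOUND-g112 §2 / census's cell checker)

`certFloor a I y τ Rc` (T2, (226) `…CoherentFloor`) sums over the WHOLE window template `a` (≈ 17.6 k sites at `Rc = 14`): its NASH column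
`τ·Σ_{z∈a∖0} ‖ψ(‖z‖²)•z − c_z(y)‖` has one Euclidean norm per site, each with the adjoint coefficient `c_z(y) = certCoeff a I y z` summing `≈ |I|`
linearised bond forces — millions of `L_v w` evaluations, not a kernel object.  Here the far parts are bounded by CLOSED FORMS in the template
separation `δ` (the sharp packing–Abel shell sums `S_k(δ,R)` of `…FarFieldSharp.sum_inv_pow_le_of_separated_sharp`):

* §1 (general `V`) `norm_ljBondForceLin_le`/`…_le'`: `‖L_v w‖ ≤ (|ψ(‖v‖²)| + 2‖v‖²|ψ′(‖v‖²)|)·‖w‖ ≤ (9‖v‖⁻⁸ + 15‖v‖⁻¹⁴)·‖w‖`;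
  `norm_psiT_smul_le`: `‖ψ(‖z‖²)•z‖ ≤ ‖z‖⁻⁷ + ‖z‖⁻¹³`; `certCoeff_eq_of_not_mem`; the NEAR adjoint coefficient `certCoeffNear a I y L z` (both sums of `certCoeff` restricted to
  bond length `< L`), `certCoeff_sub_certCoeffNear`, `norm_certCoeff_sub_certCoeffNear_le`.
* §2 (`E3`) the shell sums over a `δ`-separated finite set at distance `≥ R ≥ δ/2` from a point:
  `Σ (9d⁻⁸ + 15d⁻¹⁴) ≤ TL_δ(R) := 9S₅(δ,R) + 15S₁₁(δ,R)` (`sum_linTail_le`) and `Σ (d⁻⁷ + d⁻¹³) ≤ T0_δ(R) := S₄(δ,R) + S₁₀(δ,R)` (`sum_psiTail_le`;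
  `T0_{7/10} = farCol`).
* §3 ★ `sum_norm_certCoeff_sub_near_le` (PAIR TAIL): `Σ_{z∈a} ‖c_z(y) − c_z^{<L}(y)‖ ≤ 2·(Σ_{x∈I}‖y_x‖)·TL_δ(L)`;
  ★★ `nashColumn_le_near_add_tails` (THE NASH-COLUMN TRUNCATION): if every interior site has `‖x‖ + L ≤ R_N`, then
  `Σ_{z∈a∖0} ‖ψ(‖z‖²)•z − c_z(y)‖ ≤ Σ_{z∈a∖0, ‖z‖≤R_N} ‖ψ(‖z‖²)•z − c_z^{<L}(y)‖ + T0_δ(R_N) + 2·(Σ_{x∈I}‖y_x‖)·TL_δ(L)` — the K-file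
  evaluates the first sum only (and for the sites beyond `R_A + L` inside `R_N` the near coefficient is `0`, so their term is the shell-groupable `|ψ(‖z‖²)|·‖z‖`).
DESK SIZES (δ = 0.9, τ = 1/128, Σ‖y‖ = 0.225, FULL units after the factor τ): site tail `τ·T0_δ(10) ≈ 5·10⁻⁵`, pair tail at `L = 6` `≈ 2.5·10⁻⁵`
(`L = 4`: `≈ 2·10⁻⁴`); the `L_v w` count drops from `≈ 7·10⁶` to `≈ 403 × 1 280`.  One plain `def` (`certCoeffNear`); no instance / notation;
imports TREE (226) only; 0 sorry.  All `[folklore]`.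
-/

noncomputable section

namespace Summit.AtomisticToContinuum.Crystallization.Theorems.FrustratedLawDichotomyCertFloorTails

open Metric Set RealInnerProductSpace
open scoped BigOperators
open Summit.AtomisticToContinuum.Crystallization.Theorems.ChargedEnergyGapNegative (E3)
open Summit.AtomisticToContinuum.Crystallization.Theorems.FrustratedLawDichotomyEnergyRemainder (inv_sq_pow_eq)
open Summit.AtomisticToContinuum.Crystallization.Theorems.FrustratedLawDichotomyFarFieldSharp (sum_inv_pow_le_of_separated_sharp)
open Summit.AtomisticToContinuum.Crystallization.Theorems.FrustratedLawDichotomyCoherentFloorAlgebra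

/-! ## §1. Norm bounds for the linearised bond force and the root's first variation; the near adjoint coefficient (general `V`) -/

section General

variable {V : Type*} [NormedAddCommGroup V] [InnerProductSpace ℝ V]

/-- `‖L_v w‖ ≤ (|ψ(‖v‖²)| + 2‖v‖²·|ψ′(‖v‖²)|)·‖w‖` (triangle inequality and Cauchy–Schwarz on `ψ•w + (2⟪v,w⟫ψ′)•v`). [folklore] -/
theorem norm_ljBondForceLin_le (v w : V) :
    ‖ljBondForceLin v w‖ ≤ (|psiT (‖v‖ ^ 2)| + 2 * ‖v‖ ^ 2 * |psiT1 (‖v‖ ^ 2)|) * ‖w‖ := by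
  unfold ljBondForceLin
  have h1 : ‖psiT (‖v‖ ^ 2) • w‖ = |psiT (‖v‖ ^ 2)| * ‖w‖ := by rw [norm_smul, Real.norm_eq_abs]
  have h2 : ‖(2 * ⟪v, w⟫ * psiT1 (‖v‖ ^ 2)) • v‖ ≤ 2 * ‖v‖ ^ 2 * |psiT1 (‖v‖ ^ 2)| * ‖w‖ := by
    rw [norm_smul, Real.norm_eq_abs, abs_mul, abs_mul, abs_two]
    have h := abs_real_inner_le_norm v w
    calc 2 * |⟪v, w⟫| * |psiT1 (‖v‖ ^ 2)| * ‖v‖ ≤ 2 * (‖v‖ * ‖w‖) * |psiT1 (‖v‖ ^ 2)| * ‖v‖ := by gcongr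
      _ = 2 * ‖v‖ ^ 2 * |psiT1 (‖v‖ ^ 2)| * ‖w‖ := by ring
  calc ‖psiT (‖v‖ ^ 2) • w + (2 * ⟪v, w⟫ * psiT1 (‖v‖ ^ 2)) • v‖
      ≤ ‖psiT (‖v‖ ^ 2) • w‖ + ‖(2 * ⟪v, w⟫ * psiT1 (‖v‖ ^ 2)) • v‖ := norm_add_le _ _
    _ ≤ |psiT (‖v‖ ^ 2)| * ‖w‖ + 2 * ‖v‖ ^ 2 * |psiT1 (‖v‖ ^ 2)| * ‖w‖ := by rw [h1]; linarith
    _ = (|psiT (‖v‖ ^ 2)| + 2 * ‖v‖ ^ 2 * |psiT1 (‖v‖ ^ 2)|) * ‖w‖ := by ring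

/-- `|ψ(r²)| + 2r²|ψ′(r²)| ≤ 9r⁻⁸ + 15r⁻¹⁴` for `r ≥ 0` (`ψ(r²) = r⁻⁸ − r⁻¹⁴`, `ψ′(r²) = −4r⁻¹⁰ + 7r⁻¹⁶`). [folklore] -/
theorem abs_psiT_add_le {r : ℝ} (hr : 0 ≤ r) : |psiT (r ^ 2)| + 2 * r ^ 2 * |psiT1 (r ^ 2)| ≤ 9 * r⁻¹ ^ 8 + 15 * r⁻¹ ^ 14 := by
  have eψ : psiT (r ^ 2) = r⁻¹ ^ 8 - r⁻¹ ^ 14 := by unfold psiT; rw [inv_sq_pow_eq, inv_sq_pow_eq]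
  have eψ1 : psiT1 (r ^ 2) = -4 * r⁻¹ ^ 10 + 7 * r⁻¹ ^ 16 := by unfold psiT1; rw [inv_sq_pow_eq, inv_sq_pow_eq]
  rw [eψ, eψ1]
  rcases eq_or_lt_of_le hr with h | h
  · rw [← h]; simp
  have hi : 0 ≤ r⁻¹ := inv_nonneg.mpr hr
  have e1 : r ^ 2 * r⁻¹ ^ 10 = r⁻¹ ^ 8 := by field_simp
  have e2 : r ^ 2 * r⁻¹ ^ 16 = r⁻¹ ^ 14 := by field_simp
  have a1 : |r⁻¹ ^ 8 - r⁻¹ ^ 14| ≤ r⁻¹ ^ 8 + r⁻¹ ^ 14 :=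
    abs_le.mpr ⟨by nlinarith [pow_nonneg hi 8, pow_nonneg hi 14], by nlinarith [pow_nonneg hi 8, pow_nonneg hi 14]⟩
  have a2 : |-4 * r⁻¹ ^ 10 + 7 * r⁻¹ ^ 16| ≤ 4 * r⁻¹ ^ 10 + 7 * r⁻¹ ^ 16 :=
    abs_le.mpr ⟨by nlinarith [pow_nonneg hi 10, pow_nonneg hi 16], by nlinarith [pow_nonneg hi 10, pow_nonneg hi 16]⟩
  have a3 := mul_le_mul_of_nonneg_left a2 (by positivity : (0 : ℝ) ≤ 2 * r ^ 2)
  nlinarith [a1, a3, e1, e2]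

/-- ★ `‖L_v w‖ ≤ (9‖v‖⁻⁸ + 15‖v‖⁻¹⁴)·‖w‖` — the operator-norm majorant used for the tails. [folklore] -/
theorem norm_ljBondForceLin_le' (v w : V) : ‖ljBondForceLin v w‖ ≤ (9 * ‖v‖⁻¹ ^ 8 + 15 * ‖v‖⁻¹ ^ 14) * ‖w‖ :=
  (norm_ljBondForceLin_le v w).trans (mul_le_mul_of_nonneg_right (abs_psiT_add_le (norm_nonneg v)) (norm_nonneg w))

/-- `‖ψ(‖z‖²)•z‖ ≤ ‖z‖⁻⁷ + ‖z‖⁻¹³` (the root's first variation at a far site). [folklore] -/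
theorem norm_psiT_smul_le (z : V) : ‖psiT (‖z‖ ^ 2) • z‖ ≤ ‖z‖⁻¹ ^ 7 + ‖z‖⁻¹ ^ 13 := by
  have eψ : psiT (‖z‖ ^ 2) = ‖z‖⁻¹ ^ 8 - ‖z‖⁻¹ ^ 14 := by unfold psiT; rw [inv_sq_pow_eq, inv_sq_pow_eq]
  rw [norm_smul, Real.norm_eq_abs, eψ]
  rcases eq_or_lt_of_le (norm_nonneg z) with h | h
  · rw [← h]; simp
  have hi : 0 ≤ ‖z‖⁻¹ := inv_nonneg.mpr (norm_nonneg z)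
  have e1 : ‖z‖⁻¹ ^ 8 * ‖z‖ = ‖z‖⁻¹ ^ 7 := by field_simp
  have e2 : ‖z‖⁻¹ ^ 14 * ‖z‖ = ‖z‖⁻¹ ^ 13 := by field_simp
  have a1 : |‖z‖⁻¹ ^ 8 - ‖z‖⁻¹ ^ 14| ≤ ‖z‖⁻¹ ^ 8 + ‖z‖⁻¹ ^ 14 :=
    abs_le.mpr ⟨by nlinarith [pow_nonneg hi 8, pow_nonneg hi 14], by nlinarith [pow_nonneg hi 8, pow_nonneg hi 14]⟩
  nlinarith [mul_le_mul_of_nonneg_right a1 (norm_nonneg z), e1, e2]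

variable [DecidableEq V]

/-- Off the interior the adjoint coefficient is minus the sum over ALL interior sites. [folklore] -/
theorem certCoeff_eq_of_not_mem (a I : Finset V) (y : V → V) {z : V} (hz : z ∉ I) :
    certCoeff a I y z = -∑ x ∈ I, ljBondForceLin (x - z) (y x) := by
  unfold certCoeff
  rw [if_neg hz, Finset.erase_eq_of_notMem hz, zero_sub]

/-- The NEAR adjoint coefficient: both sums of `certCoeff a I y z` restricted to bonds of length `< L` (what a cell K-file evaluates). -/
def certCoeffNear (a I : Finset V) (y : V → V) (L : ℝ) (z : V) : V :=
  (if z ∈ I then ∑ x' ∈ (a.erase z).filter (fun x' => dist x' z < L), ljBondForceLin (z - x') (y z) else 0)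
    - ∑ x ∈ (I.erase z).filter (fun x => dist x z < L), ljBondForceLin (x - z) (y x)

/-- `c_z − c_z^{<L}` = the two FAR sums. [folklore] -/
theorem certCoeff_sub_certCoeffNear (a I : Finset V) (y : V → V) (L : ℝ) (z : V) :
    certCoeff a I y z - certCoeffNear a I y L z
      = (if z ∈ I then ∑ x' ∈ (a.erase z).filter (fun x' => ¬ dist x' z < L), ljBondForceLin (z - x') (y z) else 0)
        - ∑ x ∈ (I.erase z).filter (fun x => ¬ dist x z < L), ljBondForceLin (x - z) (y x) := by
  unfold certCoeff certCoeffNear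
  rw [← Finset.sum_filter_add_sum_filter_not (a.erase z) (fun x' => dist x' z < L),
    ← Finset.sum_filter_add_sum_filter_not (I.erase z) (fun x => dist x z < L)]
  split_ifs <;> abel

/-- Termwise bound of the far sums by the operator-norm majorant. [folklore] -/
theorem norm_certCoeff_sub_certCoeffNear_le (a I : Finset V) (y : V → V) (L : ℝ) (z : V) :
    ‖certCoeff a I y z - certCoeffNear a I y L z‖
      ≤ (if z ∈ I then ‖y z‖ * ∑ x' ∈ (a.erase z).filter (fun x' => ¬ dist x' z < L), (9 * (dist x' z)⁻¹ ^ 8 + 15 * (dist x' z)⁻¹ ^ 14) else 0)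
        + ∑ x ∈ (I.erase z).filter (fun x => ¬ dist x z < L), (9 * (dist x z)⁻¹ ^ 8 + 15 * (dist x z)⁻¹ ^ 14) * ‖y x‖ := by
  rw [certCoeff_sub_certCoeffNear]
  refine (norm_sub_le _ _).trans (add_le_add ?_ ?_)
  · split_ifs with hz
    · refine (norm_sum_le _ _).trans ?_
      rw [Finset.mul_sum]
      refine Finset.sum_le_sum fun x' _ => ?_
      have h := norm_ljBondForceLin_le' (z - x') (y z)
      rw [← dist_eq_norm, dist_comm] at h
      linarith
    · simp
  · refine (norm_sum_le _ _).trans (Finset.sum_le_sum fun x _ => ?_)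
    have h := norm_ljBondForceLin_le' (x - z) (y x)
    rwa [← dist_eq_norm] at h

end General

/-! ## §2. The shell sums of the two majorants over a separated far set (`E3`) -/

/-- `Σ_{far} (9d⁻⁸ + 15d⁻¹⁴) ≤ TL_δ(R) := 9·S₅(δ,R) + 15·S₁₁(δ,R)` over a finite `δ`-separated set at distance `≥ R ≥ δ/2` from `p`. [folklore] -/
theorem sum_linTail_le (s : Finset E3) (p : E3) {δ R : ℝ} (hδ : 0 < δ) (hR : δ / 2 ≤ R)
    (hsep : ∀ a ∈ s, ∀ b ∈ s, a ≠ b → δ ≤ dist a b) (hfar : ∀ a ∈ s, R ≤ dist a p) :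
    ∑ a ∈ s, (9 * (dist a p)⁻¹ ^ 8 + 15 * (dist a p)⁻¹ ^ 14)
      ≤ 9 * (3 / 5 * (2 / δ) ^ 3 * R⁻¹ ^ 5 + 7 * (2 / δ) ^ 2 * R⁻¹ ^ 6 + 3 / 7 * (2 / δ) * R⁻¹ ^ 7 + 2 * R⁻¹ ^ 8)
        + 15 * (3 / 11 * (2 / δ) ^ 3 * R⁻¹ ^ 11 + 13 / 2 * (2 / δ) ^ 2 * R⁻¹ ^ 12 + 3 / 13 * (2 / δ) * R⁻¹ ^ 13 + 2 * R⁻¹ ^ 14) := by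
  have h5 := sum_inv_pow_le_of_separated_sharp s p (k := 5) (by norm_num) hδ hR hsep hfar
  have h11 := sum_inv_pow_le_of_separated_sharp s p (k := 11) (by norm_num) hδ hR hsep hfar
  have e5 : (3 / ((5 : ℕ) : ℝ) * (2 / δ) ^ 3 * R⁻¹ ^ 5 + 6 * (((5 : ℕ) : ℝ) + 2) / (((5 : ℕ) : ℝ) + 1) * (2 / δ) ^ 2 * R⁻¹ ^ (5 + 1) +
        3 / (((5 : ℕ) : ℝ) + 2) * (2 / δ) * R⁻¹ ^ (5 + 2) + 2 * R⁻¹ ^ (5 + 3))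
      = 3 / 5 * (2 / δ) ^ 3 * R⁻¹ ^ 5 + 7 * (2 / δ) ^ 2 * R⁻¹ ^ 6 + 3 / 7 * (2 / δ) * R⁻¹ ^ 7 + 2 * R⁻¹ ^ 8 := by
    push_cast; ring
  have e11 : (3 / ((11 : ℕ) : ℝ) * (2 / δ) ^ 3 * R⁻¹ ^ 11 + 6 * (((11 : ℕ) : ℝ) + 2) / (((11 : ℕ) : ℝ) + 1) * (2 / δ) ^ 2 * R⁻¹ ^ (11 + 1) +
        3 / (((11 : ℕ) : ℝ) + 2) * (2 / δ) * R⁻¹ ^ (11 + 2) + 2 * R⁻¹ ^ (11 + 3))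
      = 3 / 11 * (2 / δ) ^ 3 * R⁻¹ ^ 11 + 13 / 2 * (2 / δ) ^ 2 * R⁻¹ ^ 12 + 3 / 13 * (2 / δ) * R⁻¹ ^ 13 + 2 * R⁻¹ ^ 14 := by
    push_cast; ring
  rw [e5] at h5
  rw [e11] at h11
  rw [Finset.sum_add_distrib, ← Finset.mul_sum, ← Finset.mul_sum]
  have h5' : ∑ a ∈ s, (dist a p)⁻¹ ^ 8 = ∑ a ∈ s, (dist a p)⁻¹ ^ (5 + 3) := rfl
  have h11' : ∑ a ∈ s, (dist a p)⁻¹ ^ 14 = ∑ a ∈ s, (dist a p)⁻¹ ^ (11 + 3) := rfl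
  rw [h5', h11']
  linarith

/-- `Σ_{far} (d⁻⁷ + d⁻¹³) ≤ T0_δ(R) := S₄(δ,R) + S₁₀(δ,R)` (= `farCol R` at `δ = 7/10`). [folklore] -/
theorem sum_psiTail_le (s : Finset E3) (p : E3) {δ R : ℝ} (hδ : 0 < δ) (hR : δ / 2 ≤ R)
    (hsep : ∀ a ∈ s, ∀ b ∈ s, a ≠ b → δ ≤ dist a b) (hfar : ∀ a ∈ s, R ≤ dist a p) :
    ∑ a ∈ s, ((dist a p)⁻¹ ^ 7 + (dist a p)⁻¹ ^ 13)
      ≤ (3 / 4 * (2 / δ) ^ 3 * R⁻¹ ^ 4 + 36 / 5 * (2 / δ) ^ 2 * R⁻¹ ^ 5 + 1 / 2 * (2 / δ) * R⁻¹ ^ 6 + 2 * R⁻¹ ^ 7)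
        + (3 / 10 * (2 / δ) ^ 3 * R⁻¹ ^ 10 + 72 / 11 * (2 / δ) ^ 2 * R⁻¹ ^ 11 + 1 / 4 * (2 / δ) * R⁻¹ ^ 12 + 2 * R⁻¹ ^ 13) := by
  have h4 := sum_inv_pow_le_of_separated_sharp s p (k := 4) (by norm_num) hδ hR hsep hfar
  have h10 := sum_inv_pow_le_of_separated_sharp s p (k := 10) (by norm_num) hδ hR hsep hfar
  have e4 : (3 / ((4 : ℕ) : ℝ) * (2 / δ) ^ 3 * R⁻¹ ^ 4 + 6 * (((4 : ℕ) : ℝ) + 2) / (((4 : ℕ) : ℝ) + 1) * (2 / δ) ^ 2 * R⁻¹ ^ (4 + 1) +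
        3 / (((4 : ℕ) : ℝ) + 2) * (2 / δ) * R⁻¹ ^ (4 + 2) + 2 * R⁻¹ ^ (4 + 3))
      = 3 / 4 * (2 / δ) ^ 3 * R⁻¹ ^ 4 + 36 / 5 * (2 / δ) ^ 2 * R⁻¹ ^ 5 + 1 / 2 * (2 / δ) * R⁻¹ ^ 6 + 2 * R⁻¹ ^ 7 := by
    push_cast; ring
  have e10 : (3 / ((10 : ℕ) : ℝ) * (2 / δ) ^ 3 * R⁻¹ ^ 10 + 6 * (((10 : ℕ) : ℝ) + 2) / (((10 : ℕ) : ℝ) + 1) * (2 / δ) ^ 2 * R⁻¹ ^ (10 + 1) +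
        3 / (((10 : ℕ) : ℝ) + 2) * (2 / δ) * R⁻¹ ^ (10 + 2) + 2 * R⁻¹ ^ (10 + 3))
      = 3 / 10 * (2 / δ) ^ 3 * R⁻¹ ^ 10 + 72 / 11 * (2 / δ) ^ 2 * R⁻¹ ^ 11 + 1 / 4 * (2 / δ) * R⁻¹ ^ 12 + 2 * R⁻¹ ^ 13 := by
    push_cast; ring
  rw [e4] at h4
  rw [e10] at h10
  rw [Finset.sum_add_distrib]
  have h4' : ∑ a ∈ s, (dist a p)⁻¹ ^ 7 = ∑ a ∈ s, (dist a p)⁻¹ ^ (4 + 3) := rfl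
  have h10' : ∑ a ∈ s, (dist a p)⁻¹ ^ 13 = ∑ a ∈ s, (dist a p)⁻¹ ^ (10 + 3) := rfl
  rw [h4', h10']
  linarith

/-! ## §3. The NASH-column truncation -/

/-- ★ PAIR TAIL of the adjoint coefficient: truncating both sums of `c_z(y)` to bond length `< L` (`L ≥ δ/2`, `δ` = template separation)
costs, summed over ALL sites, at most `2·(Σ_{x∈I}‖y_x‖)·TL_δ(L)`. [folklore] -/
theorem sum_norm_certCoeff_sub_near_le (a I : Finset E3) (y : E3 → E3) {δ L : ℝ} (hδ : 0 < δ) (hL : δ / 2 ≤ L)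
    (hsep : ∀ z ∈ a, ∀ z' ∈ a, z ≠ z' → δ ≤ dist z z') (hIa : I ⊆ a) :
    ∑ z ∈ a, ‖certCoeff a I y z - certCoeffNear a I y L z‖
      ≤ 2 * (∑ x ∈ I, ‖y x‖) *
        (9 * (3 / 5 * (2 / δ) ^ 3 * L⁻¹ ^ 5 + 7 * (2 / δ) ^ 2 * L⁻¹ ^ 6 + 3 / 7 * (2 / δ) * L⁻¹ ^ 7 + 2 * L⁻¹ ^ 8)
          + 15 * (3 / 11 * (2 / δ) ^ 3 * L⁻¹ ^ 11 + 13 / 2 * (2 / δ) ^ 2 * L⁻¹ ^ 12 + 3 / 13 * (2 / δ) * L⁻¹ ^ 13 + 2 * L⁻¹ ^ 14)) := by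
  classical
  set TL := 9 * (3 / 5 * (2 / δ) ^ 3 * L⁻¹ ^ 5 + 7 * (2 / δ) ^ 2 * L⁻¹ ^ 6 + 3 / 7 * (2 / δ) * L⁻¹ ^ 7 + 2 * L⁻¹ ^ 8)
    + 15 * (3 / 11 * (2 / δ) ^ 3 * L⁻¹ ^ 11 + 13 / 2 * (2 / δ) ^ 2 * L⁻¹ ^ 12 + 3 / 13 * (2 / δ) * L⁻¹ ^ 13 + 2 * L⁻¹ ^ 14) with hTL
  set g : E3 → E3 → ℝ := fun x z => 9 * (dist x z)⁻¹ ^ 8 + 15 * (dist x z)⁻¹ ^ 14 with hg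
  -- the shell-sum bound around any site `p ∈ a`, over the far part of `a.erase p`
  have hshell : ∀ p ∈ a, ∑ z ∈ (a.erase p).filter (fun z => ¬ dist z p < L), g z p ≤ TL := by
    intro p hp
    simp only [hg, hTL]
    refine sum_linTail_le _ p hδ hL (fun u hu v hv huv => ?_) (fun u hu => ?_)
    · exact hsep u (Finset.mem_of_mem_erase (Finset.mem_filter.mp hu).1) v (Finset.mem_of_mem_erase (Finset.mem_filter.mp hv).1) huv
    · exact not_lt.mp (Finset.mem_filter.mp hu).2
  -- (1) termwise
  have h1 : ∑ z ∈ a, ‖certCoeff a I y z - certCoeffNear a I y L z‖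
      ≤ ∑ z ∈ a, ((if z ∈ I then ‖y z‖ * ∑ x' ∈ (a.erase z).filter (fun x' => ¬ dist x' z < L), g x' z else 0)
          + ∑ x ∈ (I.erase z).filter (fun x => ¬ dist x z < L), g x z * ‖y x‖) :=
    Finset.sum_le_sum fun z _ => norm_certCoeff_sub_certCoeffNear_le a I y L z
  rw [Finset.sum_add_distrib] at h1
  -- (2) the `z ∈ I` part
  have h2 : ∑ z ∈ a, (if z ∈ I then ‖y z‖ * ∑ x' ∈ (a.erase z).filter (fun x' => ¬ dist x' z < L), g x' z else 0)
      ≤ (∑ x ∈ I, ‖y x‖) * TL := by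
    rw [Finset.sum_ite_mem, Finset.inter_eq_right.mpr hIa, Finset.sum_mul]
    exact Finset.sum_le_sum fun z hz => mul_le_mul_of_nonneg_left (hshell z (hIa hz)) (norm_nonneg _)
  -- (3) the other part, after exchanging the sums
  have h3 : ∑ z ∈ a, ∑ x ∈ (I.erase z).filter (fun x => ¬ dist x z < L), g x z * ‖y x‖
      = ∑ x ∈ I, ‖y x‖ * ∑ z ∈ (a.erase x).filter (fun z => ¬ dist z x < L), g x z := by
    rw [Finset.sum_comm' (t' := I) (s' := fun x => (a.erase x).filter (fun z => ¬ dist z x < L)) (h := ?_)]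
    · refine Finset.sum_congr rfl fun x _ => ?_
      rw [Finset.mul_sum]
      exact Finset.sum_congr rfl fun z _ => mul_comm _ _
    · intro z x
      simp only [Finset.mem_filter, Finset.mem_erase, dist_comm x z, ne_comm (a := x)]
      tauto
  have h4 : ∑ x ∈ I, ‖y x‖ * ∑ z ∈ (a.erase x).filter (fun z => ¬ dist z x < L), g x z ≤ (∑ x ∈ I, ‖y x‖) * TL := by
    rw [Finset.sum_mul]
    refine Finset.sum_le_sum fun x hx => mul_le_mul_of_nonneg_left ?_ (norm_nonneg _)
    have h := hshell x (hIa hx)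
    refine le_trans (le_of_eq (Finset.sum_congr rfl fun z _ => ?_)) h
    simp only [hg, dist_comm x z]
  rw [h3] at h1
  linarith

/-- ★★ **THE NASH-COLUMN TRUNCATION.**  Template `a` (`δ`-separated), interior `I ⊆ a` with `‖x‖ + L ≤ R_N` for every `x ∈ I` (`L, R_N ≥ δ/2`),
any multipliers `y`.  Then
`Σ_{z∈a∖0} ‖ψ(‖z‖²)•z − c_z(y)‖ ≤ Σ_{z∈a∖0, ‖z‖≤R_N} ‖ψ(‖z‖²)•z − c_z^{<L}(y)‖ + T0_δ(R_N) + 2·(Σ_{x∈I}‖y_x‖)·TL_δ(L)`: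
a cell K-file evaluates the first (NEAR) sum only; multiply by `τ` for the NASH column of `certFloor`. [folklore] -/
theorem nashColumn_le_near_add_tails (a I : Finset E3) (y : E3 → E3) {δ L R_N : ℝ} (hδ : 0 < δ) (hL : δ / 2 ≤ L) (hRN : δ / 2 ≤ R_N)
    (hsep : ∀ z ∈ a, ∀ z' ∈ a, z ≠ z' → δ ≤ dist z z') (hIa : I ⊆ a) (hI : ∀ x ∈ I, ‖x‖ + L ≤ R_N) :
    ∑ z ∈ a.erase 0, ‖psiT (‖z‖ ^ 2) • z - certCoeff a I y z‖
      ≤ ∑ z ∈ (a.erase 0).filter (fun z => ‖z‖ ≤ R_N), ‖psiT (‖z‖ ^ 2) • z - certCoeffNear a I y L z‖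
        + ((3 / 4 * (2 / δ) ^ 3 * R_N⁻¹ ^ 4 + 36 / 5 * (2 / δ) ^ 2 * R_N⁻¹ ^ 5 + 1 / 2 * (2 / δ) * R_N⁻¹ ^ 6 + 2 * R_N⁻¹ ^ 7)
            + (3 / 10 * (2 / δ) ^ 3 * R_N⁻¹ ^ 10 + 72 / 11 * (2 / δ) ^ 2 * R_N⁻¹ ^ 11 + 1 / 4 * (2 / δ) * R_N⁻¹ ^ 12 + 2 * R_N⁻¹ ^ 13))
        + 2 * (∑ x ∈ I, ‖y x‖) *
          (9 * (3 / 5 * (2 / δ) ^ 3 * L⁻¹ ^ 5 + 7 * (2 / δ) ^ 2 * L⁻¹ ^ 6 + 3 / 7 * (2 / δ) * L⁻¹ ^ 7 + 2 * L⁻¹ ^ 8)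
            + 15 * (3 / 11 * (2 / δ) ^ 3 * L⁻¹ ^ 11 + 13 / 2 * (2 / δ) ^ 2 * L⁻¹ ^ 12 + 3 / 13 * (2 / δ) * L⁻¹ ^ 13 + 2 * L⁻¹ ^ 14)) := by
  classical
  have hL0 : 0 < L := lt_of_lt_of_le (by positivity) hL
  -- (1) termwise split `t − c = (t − c^L) − (c − c^L)`
  have h1 : ∑ z ∈ a.erase 0, ‖psiT (‖z‖ ^ 2) • z - certCoeff a I y z‖
      ≤ ∑ z ∈ a.erase 0, ‖psiT (‖z‖ ^ 2) • z - certCoeffNear a I y L z‖ + ∑ z ∈ a.erase 0, ‖certCoeff a I y z - certCoeffNear a I y L z‖ := by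
    rw [← Finset.sum_add_distrib]
    refine Finset.sum_le_sum fun z _ => ?_
    have e : psiT (‖z‖ ^ 2) • z - certCoeff a I y z
        = (psiT (‖z‖ ^ 2) • z - certCoeffNear a I y L z) - (certCoeff a I y z - certCoeffNear a I y L z) := by abel
    rw [e]
    exact norm_sub_le _ _
  -- (2) the pair tail (over `a.erase 0 ⊆ a`)
  have h2 : ∑ z ∈ a.erase 0, ‖certCoeff a I y z - certCoeffNear a I y L z‖ ≤ ∑ z ∈ a, ‖certCoeff a I y z - certCoeffNear a I y L z‖ :=
    Finset.sum_le_sum_of_subset_of_nonneg (Finset.erase_subset 0 a) fun _ _ _ => norm_nonneg _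
  have h3 := sum_norm_certCoeff_sub_near_le a I y hδ hL hsep hIa
  -- (3) near/far split of the first sum; far sites have `c^L = 0`
  rw [← Finset.sum_filter_add_sum_filter_not (a.erase 0) (fun z => ‖z‖ ≤ R_N)
    (fun z => ‖psiT (‖z‖ ^ 2) • z - certCoeffNear a I y L z‖)] at h1
  have hfar0 : ∀ z ∈ (a.erase 0).filter (fun z => ¬ ‖z‖ ≤ R_N), certCoeffNear a I y L z = 0 := by
    intro z hz
    have hzR : R_N < ‖z‖ := not_le.mp (Finset.mem_filter.mp hz).2
    have hzI : z ∉ I := fun h => by have := hI z h; linarith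
    unfold certCoeffNear
    rw [if_neg hzI, zero_sub, neg_eq_zero]
    refine Finset.sum_eq_zero fun x hx => ?_
    exfalso
    obtain ⟨hx1, hx2⟩ := Finset.mem_filter.mp hx
    have hxI := Finset.mem_of_mem_erase hx1
    have h4 := hI x hxI
    have h5 : ‖z‖ - ‖x‖ ≤ dist x z := by rw [dist_comm, dist_eq_norm]; exact norm_sub_norm_le z x
    linarith
  have h4 : ∑ z ∈ (a.erase 0).filter (fun z => ¬ ‖z‖ ≤ R_N), ‖psiT (‖z‖ ^ 2) • z - certCoeffNear a I y L z‖
      ≤ (3 / 4 * (2 / δ) ^ 3 * R_N⁻¹ ^ 4 + 36 / 5 * (2 / δ) ^ 2 * R_N⁻¹ ^ 5 + 1 / 2 * (2 / δ) * R_N⁻¹ ^ 6 + 2 * R_N⁻¹ ^ 7)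
          + (3 / 10 * (2 / δ) ^ 3 * R_N⁻¹ ^ 10 + 72 / 11 * (2 / δ) ^ 2 * R_N⁻¹ ^ 11 + 1 / 4 * (2 / δ) * R_N⁻¹ ^ 12 + 2 * R_N⁻¹ ^ 13) := by
    have h5 : ∑ z ∈ (a.erase 0).filter (fun z => ¬ ‖z‖ ≤ R_N), ‖psiT (‖z‖ ^ 2) • z - certCoeffNear a I y L z‖
        ≤ ∑ z ∈ (a.erase 0).filter (fun z => ¬ ‖z‖ ≤ R_N), ((dist z (0 : E3))⁻¹ ^ 7 + (dist z (0 : E3))⁻¹ ^ 13) := by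
      refine Finset.sum_le_sum fun z hz => ?_
      rw [hfar0 z hz, sub_zero, dist_zero_right]
      exact norm_psiT_smul_le z
    refine h5.trans (sum_psiTail_le _ 0 hδ hRN (fun u hu v hv huv => ?_) (fun u hu => ?_))
    · exact hsep u (Finset.mem_of_mem_erase (Finset.mem_filter.mp hu).1) v
        (Finset.mem_of_mem_erase (Finset.mem_filter.mp hv).1) huv
    · rw [dist_zero_right]
      exact (not_le.mp (Finset.mem_filter.mp hu).2).le
  linarith

end Summit.AtomisticToContinuum.Crystallization.Theorems.FrustratedLawDichotomyCertFloorTails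

end
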